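import Summits.CriticalPhenomena.PercolationContinuityZ3.Theorems.PercAnnulusCrossingIICNearPoint
import HarnessLib

/-!
# The IIC hitting a far SET, lower bound: the arm of the root picks up a shape at the price of the shape's arm (lane RSW3, p1 gen 26)

builds on p205010 (kernel theorem, internal audit signed; external expert review pending) — NOT used in this file (every `d`, `p`; Harris,
`CU⁺_l`, the IIC limit property).

RSW3 lane (LANE 3 `prim-rsw3`), seat `prim-rsw3-p1` (gen 26).  Helper file (`--supports stmt-CriticalPhenomena-4575`); no definitions,
no sorries.  Memo `run/shared/lean/prim/rsw3/P1-QM.md` §39.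

Gen 22 (`…IICNearPoint` §3–§4) glued the arm of the root to the arm of a BALL `Λ_x(m)` through one glued annulus `U(a, la)`
(`‖x‖ + m ≤ a − 1`); the proof uses the ball only through `Λ_x(m) ⊆ Λ(a−1)`.  Here the ball is an ARBITRARY finite shape `x + S`, `S ⊆ Λ(m)`:
the price is the probability of the arm of the shape, `P(x + S ↔ x + ∂ⁱⁿΛ(la + a) in x + Λ(la+a))` — its one-arm capacity at scale `(l+1)a`
times `π((l+1)a)` (`…IICCapacity`).

* **`real_inter_exists_openConnIn_set_inter_siteToBoundary_ge`** — every `d`, `p`, `CU⁺_l(c_U)`; `a ≥ 1`, `‖x‖ + m ≤ a − 1`, `S ⊆ Λ(m)`,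
  `la ≤ N`, `E` increasing measurable:
  **`c_U · P(x + S ↔ x + ∂ⁱⁿΛ(la+a) in x + Λ(la+a)) · P(E ∩ A_N) ≤ P(E ∩ {∃ q ∈ x + S, 0 ↔ q in Λ(la)} ∩ A_N)`**;
* **`iicMeasure_real_inter_exists_openConnIn_set_ge_of_isUpperSet`** — for every finite measure `ν` with Kesten's IIC limit property and
  every increasing cylinder `E`: **`c_U · P(x + S ↔ x + ∂ⁱⁿΛ(la+a) in x + Λ(la+a)) · ν(E) ≤ ν(E ∩ {∃ q ∈ x + S, 0 ↔ q in Λ(la)})`** — ON EVERY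
  INCREASING EVENT, THE IIC PICKS UP A SHAPE AT THE PRICE OF THE SHAPE'S ARM; `S = Λ(m)` is gen 22.
References: T. E. Harris, Proc. Camb. Phil. Soc. 56 (1960) Lemma 4.1; H. Kesten, PTRF 73 (1986) §2, Thm. (8).
-/

noncomputable section

namespace Summit.CriticalPhenomena.PercolationContinuityZ3.Theorems.Crossing

open MeasureTheory Filter Topology Literature.Probability.Percolation Literature.Probability.LatticeModels
open Literature.Probability.Percolation.DCT16
open Summit.CriticalPhenomena.PercolationContinuityZ3.Theorems.SurfaceTension

variable {d : ℕ}

/-! ## §1 Under `P_p`: Harris for the arm of the shape, `CU⁺_l` for the glueing -/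

/-- **THE ARM OF THE ROOT PICKS UP A SHAPE AT THE PRICE OF THE SHAPE'S ARM, ON EVERY INCREASING EVENT** (every `d`, `p`; `CU⁺_l(c_U)`,
`l ≥ 2`, `c_U ≥ 0`; `a ≥ 1`, `‖x‖ + m ≤ a − 1`, `S ⊆ Λ(m)`, `la ≤ N`): for every increasing measurable `E`,
**`c_U · P_p(x + S ↔ x + ∂ⁱⁿΛ(la + a) in x + Λ(la+a)) · P_p(E ∩ A_N) ≤ P_p(E ∩ {∃ q ∈ x + S, 0 ↔ q in Λ(la)} ∩ A_N)`** (Harris for the two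
increasing events; on `U(a,la)` the far-reaching path from the shape is glued to the arm of the root,
`openConnIn_box_of_annulusUniq_of_openConnIn_far`). [cite: Harris1960, Lemma 4.1] [cite: Kesten1986, §2] -/
theorem real_inter_exists_openConnIn_set_inter_siteToBoundary_ge (p : unitInterval) {l : ℕ} (hl : 2 ≤ l) {cU : ℝ} (hcU : 0 ≤ cU)
    (hCU : ∀ a : ℕ, 1 ≤ a → ∀ E : Set (BondConfig (Site d)), IsUpperSet E → MeasurableSet E →
      cU * (bondPercolation (zdGraph d) p).real E ≤ (bondPercolation (zdGraph d) p).real (E ∩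
        {ω : BondConfig (Site d) | ∀ t ∈ innerBoundary (zdGraph d) (box d a), ∀ s ∈ innerBoundary (zdGraph d) (box d (l * a)),
        ∀ t' ∈ innerBoundary (zdGraph d) (box d a), ∀ s' ∈ innerBoundary (zdGraph d) (box d (l * a)),
        ω ∈ openConnIn (↑((box d (l * a) \ box d a) ∪ innerBoundary (zdGraph d) (box d a)) : Set (Site d)) t s →
        ω ∈ openConnIn (↑((box d (l * a) \ box d a) ∪ innerBoundary (zdGraph d) (box d a)) : Set (Site d)) t' s' →
        ω ∈ openConnIn (↑((box d (l * a) \ box d a) ∪ innerBoundary (zdGraph d) (box d a)) : Set (Site d)) s s'}))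
    {E : Set (BondConfig (Site d))} (hE : IsUpperSet E) (hEm : MeasurableSet E) {a m : ℕ} (ha : 1 ≤ a) (x : Site d)
    (hx : Site.supNorm x + m ≤ a - 1) (S : Finset (Site d)) (hS : S ⊆ box d m) {N : ℕ} (hN : l * a ≤ N) :
    cU * (bondPercolation (zdGraph d) p).real {ω : BondConfig (Site d) | ∃ q ∈ S.image (· + x),
          ∃ t ∈ (innerBoundary (zdGraph d) (box d (l * a + a))).image (· + x), ω ∈ openConnIn (↑((box d (l * a + a)).image (· + x)) : Set (Site d)) q t} *
        (bondPercolation (zdGraph d) p).real (E ∩ siteToBoundary d N) ≤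
      (bondPercolation (zdGraph d) p).real
        (E ∩ {ω | ∃ q ∈ S.image (· + x), ω ∈ openConnIn (↑(box d (l * a)) : Set (Site d)) 0 q} ∩ siteToBoundary d N) := by
  classical
  set μ := bondPercolation (zdGraph d) p with hμ
  have hla : a < l * a := by nlinarith
  set V : Set (BondConfig (Site d)) := {ω : BondConfig (Site d) | ∃ q ∈ S.image (· + x),
      ∃ t ∈ (innerBoundary (zdGraph d) (box d (l * a + a))).image (· + x),
        ω ∈ openConnIn (↑((box d (l * a + a)).image (· + x)) : Set (Site d)) q t} with hV
  have hVeq : V = ⋃ q ∈ S.image (· + x), ⋃ t ∈ (innerBoundary (zdGraph d) (box d (l * a + a))).image (· + x),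
      (openConnIn (↑((box d (l * a + a)).image (· + x)) : Set (Site d)) q t : Set (BondConfig (Site d))) := by
    ext ω; simp only [hV, Set.mem_setOf_eq, Set.mem_iUnion, exists_prop]
  have hVu : IsUpperSet V := by
    rw [hVeq]; exact isUpperSet_iUnion₂ fun q _ => isUpperSet_iUnion₂ fun t _ => isUpperSet_openConnIn _ q t
  have hVm : MeasurableSet V := by
    rw [hVeq]
    exact Finset.measurableSet_biUnion _ fun q _ => Finset.measurableSet_biUnion _ fun t _ => measurableSet_openConnIn_of_countable _ q t
  set F : Set (BondConfig (Site d)) := E ∩ siteToBoundary d N ∩ V with hF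
  have hFup : IsUpperSet F := (hE.inter (isUpperSet_siteToBoundary d N)).inter hVu
  have hFm : MeasurableSet F := (hEm.inter (measurableSet_siteToBoundary d N)).inter hVm
  have hH : μ.real (E ∩ siteToBoundary d N) * μ.real V ≤ μ.real F :=
    harris_fkg_holds (zdGraph d) p (hE.inter (isUpperSet_siteToBoundary d N)) hVu (hEm.inter (measurableSet_siteToBoundary d N)) hVm
  have hCUF := hCU a ha F hFup hFm
  have hmono : μ.real (F ∩ {ω : BondConfig (Site d) | ∀ t ∈ innerBoundary (zdGraph d) (box d a),
        ∀ s ∈ innerBoundary (zdGraph d) (box d (l * a)), ∀ t' ∈ innerBoundary (zdGraph d) (box d a), ∀ s' ∈ innerBoundary (zdGraph d) (box d (l * a)),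
        ω ∈ openConnIn (↑((box d (l * a) \ box d a) ∪ innerBoundary (zdGraph d) (box d a)) : Set (Site d)) t s →
        ω ∈ openConnIn (↑((box d (l * a) \ box d a) ∪ innerBoundary (zdGraph d) (box d a)) : Set (Site d)) t' s' →
        ω ∈ openConnIn (↑((box d (l * a) \ box d a) ∪ innerBoundary (zdGraph d) (box d a)) : Set (Site d)) s s'}) ≤
      μ.real (E ∩ {ω | ∃ q ∈ S.image (· + x), ω ∈ openConnIn (↑(box d (l * a)) : Set (Site d)) 0 q} ∩ siteToBoundary d N) := by
    refine real_mono_of_forall_subset_edgeSet (zdGraph d) p fun ω hω h => ?_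
    obtain ⟨⟨⟨hωE, hωN⟩, q, hq, t, ht, hqt⟩, hωU⟩ := h
    refine ⟨⟨hωE, q, hq, ?_⟩, hωN⟩
    obtain ⟨y, hy, h0y⟩ := hωN
    have hyla : y ∉ box d (l * a - 1) := notMem_box_of_mem_innerBoundary_box (by omega) hy
    have h0 : ω ∈ siteToBoundary d (l * a) := siteToBoundary_of_openConnIn_of_notMem (by omega) hω hyla h0y
    -- `q ∈ Λ(a−1)` and `t ∉ Λ(la−1)`
    obtain ⟨q₀, hq₀, rfl⟩ := Finset.mem_image.1 hq
    obtain ⟨t₀, ht₀, rfl⟩ := Finset.mem_image.1 ht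
    have hqa : q₀ + x ∈ box d (a - 1) := by
      have h1 := mem_box_iff_supNorm_le.1 (hS hq₀)
      have h2 := Site.supNorm_add_le q₀ x
      exact mem_box_iff_supNorm_le.2 (by omega)
    have htla : t₀ + x ∉ box d (l * a - 1) := by
      intro h
      have h1 := mem_box_iff_supNorm_le.1 h
      have h2 : ¬ Site.supNorm t₀ ≤ l * a + a - 1 := fun h' =>
        notMem_box_of_mem_innerBoundary_box (by omega : l * a + a - 1 < l * a + a) ht₀ (mem_box_iff_supNorm_le.2 h')
      have h3 : Site.supNorm t₀ ≤ Site.supNorm (t₀ + x) + Site.supNorm x := by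
        have h := Site.supNorm_add_le (t₀ + x) (-x)
        rwa [Site.supNorm_neg, add_neg_cancel_right] at h
      omega
    exact openConnIn_box_of_annulusUniq_of_openConnIn_far ha hla hω hωU h0 hqa htla hqt
  calc cU * μ.real V * μ.real (E ∩ siteToBoundary d N) = cU * (μ.real (E ∩ siteToBoundary d N) * μ.real V) := by ring
    _ ≤ cU * μ.real F := mul_le_mul_of_nonneg_left hH hcU
    _ ≤ _ := hCUF
    _ ≤ _ := hmono

/-! ## §2 Under the IIC -/

/-- **THE IIC PICKS UP A SHAPE AT THE PRICE OF THE SHAPE'S ARM, on increasing cylinders** (every `d ≥ 1`, `p > 0`; `CU⁺_l(c_U)`, `l ≥ 2`,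
`c_U ≥ 0`; `a ≥ 1`, `‖x‖ + m ≤ a − 1`, `S ⊆ Λ(m)`): for every measure `ν` with Kesten's IIC limit property and every increasing cylinder event `E`:
**`c_U · P_p(x + S ↔ x + ∂ⁱⁿΛ(la+a) in x + Λ(la+a)) · ν(E) ≤ ν(E ∩ {∃ q ∈ x + S, 0 ↔ q in Λ(la)})`**; `S = Λ(m)` is `…IICNearPoint`.
[cite: Kesten1986, Thm. (8)] [cite: Harris1960, Lemma 4.1] -/
theorem iicMeasure_real_inter_exists_openConnIn_set_ge_of_isUpperSet (hd : 1 ≤ d) (p : unitInterval) (hp : 0 < (p : ℝ)) {l : ℕ}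
    (hl : 2 ≤ l) {cU : ℝ} (hcU : 0 ≤ cU)
    (hCU : ∀ a : ℕ, 1 ≤ a → ∀ E : Set (BondConfig (Site d)), IsUpperSet E → MeasurableSet E →
      cU * (bondPercolation (zdGraph d) p).real E ≤ (bondPercolation (zdGraph d) p).real (E ∩
        {ω : BondConfig (Site d) | ∀ t ∈ innerBoundary (zdGraph d) (box d a), ∀ s ∈ innerBoundary (zdGraph d) (box d (l * a)),
        ∀ t' ∈ innerBoundary (zdGraph d) (box d a), ∀ s' ∈ innerBoundary (zdGraph d) (box d (l * a)),
        ω ∈ openConnIn (↑((box d (l * a) \ box d a) ∪ innerBoundary (zdGraph d) (box d a)) : Set (Site d)) t s →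
        ω ∈ openConnIn (↑((box d (l * a) \ box d a) ∪ innerBoundary (zdGraph d) (box d a)) : Set (Site d)) t' s' →
        ω ∈ openConnIn (↑((box d (l * a) \ box d a) ∪ innerBoundary (zdGraph d) (box d a)) : Set (Site d)) s s'}))
    {ν : Measure (BondConfig (Site d))} [IsFiniteMeasure ν]
    (hν : ∀ (F : Finset (Sym2 (Site d))) (E : Set (BondConfig (Site d))), MeasurableSet E → DeterminedBy E ↑F →
      Tendsto (fun n : ℕ => (bondPercolation (zdGraph d) p).real (E ∩ siteToBoundary d n) / oneArmProb d p n)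
        atTop (𝓝 (ν.real E)))
    {E : Set (BondConfig (Site d))} (hE : IsUpperSet E) (hEl : IsLocalEvent E) {a m : ℕ} (ha : 1 ≤ a) (x : Site d)
    (hx : Site.supNorm x + m ≤ a - 1) (S : Finset (Site d)) (hS : S ⊆ box d m) :
    cU * (bondPercolation (zdGraph d) p).real {ω : BondConfig (Site d) | ∃ q ∈ S.image (· + x),
          ∃ t ∈ (innerBoundary (zdGraph d) (box d (l * a + a))).image (· + x), ω ∈ openConnIn (↑((box d (l * a + a)).image (· + x)) : Set (Site d)) q t} *
        ν.real E ≤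
      ν.real (E ∩ {ω | ∃ q ∈ S.image (· + x), ω ∈ openConnIn (↑(box d (l * a)) : Set (Site d)) 0 q}) := by
  classical
  have hπ : ∀ n, 0 < oneArmProb d p n := oneArmProb_pos hd p hp
  have hEm : MeasurableSet E := measurableSet_of_isLocalEvent_holds hEl
  obtain ⟨FE, hFE⟩ := hEl
  set H : Set (BondConfig (Site d)) := {ω | ∃ q ∈ S.image (· + x), ω ∈ openConnIn (↑(box d (l * a)) : Set (Site d)) 0 q} with hH
  have hHeq : H = ⋃ q ∈ S.image (· + x), (openConnIn (↑(box d (l * a)) : Set (Site d)) (0 : Site d) q : Set (BondConfig (Site d))) := by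
    ext ω; simp only [hH, Set.mem_setOf_eq, Set.mem_iUnion, exists_prop]
  have hHdet : DeterminedBy H (↑(box d (l * a)).sym2 : Set (Sym2 (Site d))) := by
    rw [hHeq]
    exact DeterminedBy.iUnion fun q => DeterminedBy.iUnion fun _ =>
      determinedBy_openConnIn (↑(box d (l * a))) 0 q (K := ↑(box d (l * a)).sym2) (by rw [Finset.coe_sym2])
  have hloc₂ : IsLocalEvent (E ∩ H) := by
    refine ⟨FE ∪ (box d (l * a)).sym2, ?_⟩
    rw [Finset.coe_union]
    exact (hFE.mono Set.subset_union_left).inter (hHdet.mono Set.subset_union_right)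
  have hlim₁ := tendsto_iicMeasure_of_isLocalEvent p hν ⟨FE, hFE⟩
  have hlim₂ := tendsto_iicMeasure_of_isLocalEvent p hν hloc₂
  refine le_of_tendsto_of_tendsto' ((hlim₁.const_mul _).comp (tendsto_add_atTop_nat (l * a))) (hlim₂.comp (tendsto_add_atTop_nat (l * a)))
    fun n => ?_
  simp only [Function.comp]
  rw [← mul_div_assoc]
  exact div_le_div_of_nonneg_right
    (real_inter_exists_openConnIn_set_inter_siteToBoundary_ge p hl hcU hCU hE hEm ha x hx S hS (by omega)) (hπ _).le

end Summit.CriticalPhenomena.PercolationContinuityZ3.Theorems.Crossing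

end
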